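import Summits.CriticalPhenomena.PercolationContinuityZ3.Theorems.PercNearOneGluingNoHeavyLowerTailSunflowerPartitionLemma
import HarnessLib

/-!
# `NoHeavyLowerTail` (crux stmt-CriticalPhenomena-4575), abstract sunflower cubic: "LEMMA B" of the partition-lemma programme is FALSE
# (refutation of `SunflowerPartition.PartitionLemmaB` by the doubled star on six coordinates)

Support file (seat `prim-l12-p2` gen 5; `--supports stmt-CriticalPhenomena-4575`; refutes the `@[conjecture]` `PartitionLemmaB` of
`…SunflowerPartitionLemma` (seat prim-ineq-prove-1 gen 25)).  No named facts, no `sorry`, no `native_decide` (`decide +kernel`, ≈ 30 s).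
Memo: run/shared/lean/prim/prim-l12/prim-l12-p2/FINDING-g5-LEMMA-B-FALSE.md.

THE COUNTEREXAMPLE.  Ground set `Fin 6` = the three edges of the star `K_{1,3}` each CLONED twice (clone group `k` = `{2k, 2k+1}`);
the sunflower is the percolation three-point sunflower of that multigraph: `V i` = edge sets joining the two leaves other than `i`
through the hub = sets hitting both clone groups `≠ i`; kernel = sets hitting all three groups; bottom = sets hitting at most one group.
Counting ordered 3-partitions: `N(A,B,B) = 37`, `Σ_{i<j} N(C_i,C_j,B) = 30`, `N(C₁,C₂,C₃) = 8`, so the Lemma-B slack is `37 − 30 − 8 = −1`,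
i.e. `ZB = −6` (`exists_sunflower_ZB_neg`, definition-free: the witness is built inline), contradicting `PartitionLemmaB`
(`not_partitionLemmaB`).  The partition lemma ★ itself holds there
(`ZA = 48`, `ZH = 42`): the kernel-spectator Gladkov slack pays for the deficit.

WHY (law level).  `vB` is six times the polarisation of the cubic `q·AG − e₃ = Hb`; by the cloning reduction of the memo of prove-1 (§3b),
Lemma B for all monotone maps would give `Hb ≥ 0` for every product measure, which is false on every star with `t > q` (the SF3-Hmax regime
split).  Consequence for ★: `N(C₁,C₂,C₃) ≤ [N(A,A,B) − Σ N(C_i,C_j,A)] + [N(A,B,B) − Σ N(C_i,C_j,B)]` must be proved with BOTH antipodal-Gladkov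
slacks (stars exhaust the bottom-spectator slack, products/triangles the top-spectator one).
-/

namespace Summit.CriticalPhenomena.PercolationContinuityZ3.Theorems.SunflowerPartition

open Finset

/-- **The doubled star has `ZB = −6`.**  Witness: the percolation three-point sunflower of the star `K_{1,3}` with every edge cloned
twice, on the ground set `Fin 6` (clone group `k` = `{2k, 2k+1}`): `V i` = edge sets hitting both clone groups `≠ i` (= joining the two
leaves other than `i` through the hub); kernel = sets hitting all three groups, bottom = sets hitting at most one.  Counts of ordered
3-partitions: `N(A,B,B) = 37`, `Σ_{i<j} N(C_i,C_j,B) = 30`, `N(C₁,C₂,C₃) = 8`, so `ZB = 6·(37 − 30 − 8) = −6`; evaluated by the kernel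
(`decide +kernel`). [this work] -/
theorem exists_sunflower_ZB_neg : ∃ F : Sunflower (Fin 6), F.ZB = -6 := by
  refine ⟨⟨fun i => Finset.univ.filter fun S => ∀ k : Fin 3, k ≠ i → ∃ x ∈ S, x.val / 2 = k.val, ?_, ?_⟩, ?_⟩
  · intro i S T hST hS
    simp only [Finset.coe_filter, Finset.mem_univ, true_and, Set.mem_setOf_eq] at hS ⊢
    intro k hk
    obtain ⟨x, hx, hxk⟩ := hS k hk
    exact ⟨x, hST hx, hxk⟩
  · intro i j hij
    ext S
    simp only [Finset.mem_inter, Finset.mem_filter, Finset.mem_univ, true_and]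
    constructor
    · rintro ⟨hi, hj⟩
      have hall : ∀ k : Fin 3, ∃ x ∈ S, x.val / 2 = k.val := fun k => by
        by_cases hki : k = i
        · subst hki; exact hj k hij
        · exact hi k hki
      exact ⟨fun k _ => hall k, fun k _ => hall k⟩
    · rintro ⟨h0, h1⟩
      have hall : ∀ k : Fin 3, ∃ x ∈ S, x.val / 2 = k.val := fun k => by
        by_cases hk0 : k = 0
        · subst hk0; exact h1 0 (by decide)
        · exact h0 k hk0
      exact ⟨fun k _ => hall k, fun k _ => hall k⟩
  · decide +kernel

/-- **Lemma B is false**: the `@[conjecture]` `PartitionLemmaB` ("`0 ≤ ZB` for every sunflower on every finite ground set") fails for the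
doubled star on `Fin 6`. [this work] -/
theorem not_partitionLemmaB : ¬ PartitionLemmaB := by
  intro h
  obtain ⟨F, hF⟩ := exists_sunflower_ZB_neg
  have h6 := h (Fin 6) F
  omega

end Summit.CriticalPhenomena.PercolationContinuityZ3.Theorems.SunflowerPartition
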